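import Literature.ModelTheory.FiniteModelTheory.ESOVerifier
import Literature.ModelTheory.FiniteModelTheory.FaginTableau
import HarnessLib

/-!
# Fagin's theorem `∃SO = NP`: discharge of the named fact `fagin_theorem` of `ESO.lean`

Topic `Literature/ModelTheory/FiniteModelTheory`; sibling of `ESO.lean` (which it cannot be
appended to: the proof files import `ESO.lean`). Fagin's theorem (Fagin 1974; Immerman 1999,
Thm. 7.8 "`NP = SO∃`"; Libkin 2004, Thm. 9.6 "`∃SO` captures `NP`") in the tree's form
`Literature.ModelTheory.FiniteModelTheory.fagin_theorem`: over a non-degenerate relational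
vocabulary, an isomorphism-closed class of finite structures is `∃SO`-definable iff the language
of its codes is in `NP`. The two halves are proved in `ESOVerifier.lean` (`eso_subset_NP_holds`:
guess the witness tables, evaluate the first-order part in polynomial time — Libkin 2004,
Prop. 6.6 and p. 170) and `FaginTableau.lean` (`NP_subset_eso_holds`: Libkin's sentence (9.1) over
the Cook–Levin tableau of a `FinTM2` verifier — pp. 170–173), and glued by
`fagin_theorem_of_directions` (`Fagin.lean`).

## References

* R. Fagin, *Generalized first-order spectra and polynomial-time recognizable sets*, in:
  Complexity of Computation, SIAM–AMS Proc. 7 (1974), 43–73.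
* N. Immerman, *Descriptive Complexity*, Springer 1999, Thm. 7.8.
* L. Libkin, *Elements of Finite Model Theory*, Springer 2004, Thm. 9.6 (pp. 169–173).
-/

namespace Literature.ModelTheory.FiniteModelTheory

/-- **Fagin's theorem** (discharge of `fagin_theorem`): over a non-degenerate relational
vocabulary, a class of finite structures closed under isomorphism is definable by an existential
second-order sentence iff the language of its codes is in `NP`. From the two directions
`eso_subset_NP_holds` (`ESOVerifier.lean`) and `NP_subset_eso_holds` (`FaginTableau.lean`) by
`fagin_theorem_of_directions`. [Fagin 1974, main theorem; Immerman 1999, Thm. 7.8; Libkin 2004,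
Thm. 9.6] [cite: Immerman1999, Thm. 7.8] -/
theorem fagin_theorem_holds : fagin_theorem :=
  fagin_theorem_of_directions eso_subset_NP_holds NP_subset_eso_holds

end Literature.ModelTheory.FiniteModelTheory
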